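import Summits.Ventures.PercRepro.C041PathZones
import Summits.Ventures.PercRepro.C041CycleOne

/-!
# ROW C-041 — THE EDGE AND TREE DICTIONARIES AND THE ONE-ZONE CYCLES, by name (p6, gen 31; the summary module of
the dictionary chain)

Every end theorem restated with all its hypotheses in the type, for the referees' tree read: THE EDGE DICTIONARY
(`row_C041_edge_dict`), THE TREE DICTIONARY (`row_C041_tree_dict`, `row_C041_tree_counts`), the three-edge path
zone (`row_C041_path3`), and the cycle with one cone zone (`row_C041_cycle_one_oCube`).
-/

namespace PercRepro

namespace ZoneZ

open ZoneData TreeClosure TwoExit AZone Finset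

/-- **THE EDGE DICTIONARY**: hanging a zone by one edge applies `ℓψ` to its six-vector. -/
theorem row_C041_edge_dict {V E T₁ T₂ : Type} (Z : ZoneData V E T₁ T₂) (k : V) [Fintype E] [DecidableEq E]
    [Fintype T₁] [DecidableEq T₁] [Fintype T₂] [DecidableEq T₂] :
    (Pendant.pendant AZone.K₂ true Z k).sixVec (Sum.inl false) = ellv (Z.sixVec k) :=
  sixVec_edgePendant Z k

/-- **THE TREE DICTIONARY**: the six-vector of the canonical zone of every rooted marked tree is the
`ℓψ`-recursion. -/
theorem row_C041_tree_dict (t : TZ) : t.toZone.sixVec t.root = treeVec t :=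
  sixVec_toZone t

/-- **THE RECURSIONS AGREE**: mine-3's four counts of a tree are the root 4-vector of the six-vector of its canonical
zone. -/
theorem row_C041_tree_counts (t : TZ) :
    t.counts = (t.toZone.sixVec t.root 0, t.toZone.sixVec t.root 1 - t.toZone.sixVec t.root 0,
      t.toZone.sixVec t.root 2 - t.toZone.sixVec t.root 0,
      t.toZone.sixVec t.root 4 + t.toZone.sixVec t.root 5 - t.toZone.sixVec t.root 3) :=
  counts_eq_sixVec_toZone t

/-- **The three-edge path zone** carries `ℓψ(Π A · ℓψ(Π B · ℓψ(Π C)))` — a tree term of mine-3's square reduction. -/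
theorem row_C041_path3 (A B C : AZone) [Fintype A.E] [DecidableEq A.E] [Fintype A.T₁] [DecidableEq A.T₁]
    [Fintype A.T₂] [DecidableEq A.T₂] [Fintype B.E] [DecidableEq B.E] [Fintype B.T₁] [DecidableEq B.T₁]
    [Fintype B.T₂] [DecidableEq B.T₂] [Fintype C.E] [DecidableEq C.E] [Fintype C.T₁] [DecidableEq C.T₁]
    [Fintype C.T₂] [DecidableEq C.T₂] :
    (path3 A B C).Z.sixVec (path3 A B C).k =
      ellv (A.Z.sixVec A.k * ellv (B.Z.sixVec B.k * ellv (C.Z.sixVec C.k))) :=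
  sixVec_path3 A B C

/-- **A cycle with one cone zone satisfies the ZONE O-CUBE.** -/
theorem row_C041_cycle_one_oCube (n : ℕ) (i j : Fin (n + 1)) (hi : 0 < i.val) (hij : i.val < j.val)
    {V E T₁ T₂ : Type} (Z : ZoneData V E T₁ T₂) (a : V) [Fintype E] [DecidableEq E] [Fintype T₁] [DecidableEq T₁]
    [Fintype T₂] [DecidableEq T₂] (h : InCone (Z.sixVec a)) :
    (cyc2 n i j Z a (PointZone.pointZone 0 0) ()).ZoneOCubeConj {Sum.inl (Sum.inl 0)}
      (∅ : Set ((Fin (n + 1) ⊕ Unit) ⊕ V)) :=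
  zoneOCubeConj_cyc2_one n i j Z a hi hij h

end ZoneZ

end PercRepro
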